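import Literature.NumberTheory.EllipticCurves.EisensteinWeightOneRowKernel
import Literature.NumberTheory.LFunctions.PeriodicAbelSummation
import Mathlib.Analysis.PSeries
import Mathlib.Analysis.Complex.LocallyUniformLimit
import HarnessLib

/-!
# Hecke's convergence trick for the rows of the weight-one Eisenstein series: continuation in `s`

Topic `Literature/NumberTheory/EllipticCurves`; namespace
`Literature.NumberTheory.EllipticCurves.ModularForms`. Definitions with bodies
(`secondDiffRowKernel`,
`rowSum`, `rowCont`) and theorems; no named fact.

For a `P`-periodic weight `χ : ℤ → ℂ` of mean zero (a non-trivial Dirichlet character mod `P`) and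
`Im w > 0`, the **row** of Hecke's weight-one Eisenstein series through `w = cz` is

  `R(χ, w, s) = ∑_{d ∈ ℤ} χ(d) k(w, s; d)`,
  `k(w, s; t) = (t+w)^{-1-s}(t+w̄)^{-s} = (t+w)⁻¹|t+w|^{-2s}`

(`rowSum`; `EisensteinWeightOneRowKernel.lean`), absolutely convergent only for `Re s > 0`. Summing
by parts twice against `χ` (`PeriodicAbelSummation.lean`) gives the **continued row**

  `R̃(χ, w, s) = ∑_{d ∈ ℤ} W₀₀(d) ∇²k(w, s; d)`,   `∇²k(d) = k(d-2) - 2k(d-1) + k(d)`   (`rowCont`),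

with `W₀₀` the bounded periodic second primitive of `χ`. We prove:

* `summable_norm_int_add_rpow_neg` — `∑_{d ∈ ℤ} |d + w|^{-a} < ∞` for `a > 1`;
  `summable_norm_rowKernel_int` — `∑_d ‖k(w, s; d)‖ < ∞` for `Re s > 0`;
* `rowSum_eq_rowCont` — **`R = R̃` on `Re s > 0`** (Abel twice; no boundary terms);
* `norm_rowCont_le` —
  **`‖R̃(χ, w, s)‖ ≤ 40 P (∑_{i mod P}‖χ i‖) (1+‖s‖)² e^{2π|Im s|} I(3+2σ) (Im w)^{-2-2σ}`** for
  `σ = Re s > -1` (`I(a) = ∫_ℝ (1+v²)^{-a/2} dv`) — the decay in `Im w = c·Im z` that makes the rows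
  summable over `c` for `σ > -1/2`;
* `differentiableOn_rowCont` — **`s ↦ R̃(χ, w, s)` is holomorphic on `Re s > -1`** (termwise entire;
  on a box `a < Re s < b`, `|Im s| < T` the terms are dominated by
  `C ∫_{d-2}^{d} (|u+w|^{-3-2a} + |u+w|^{-3-2b}) du`, which is summable over `d`).

So `R̃` is the analytic continuation of the row from `Re s > 0` to `Re s > -1`, in particular to a
neighbourhood of `s = 0` — Hecke's convergence trick (Hecke 1927, §2; Schoeneberg VII §2) carried
out by Abel summation instead of Poisson summation. The value
`R̃(χ, w, 0) = ∑_{d₀ mod P} χ(d₀) (π/P) cot(π(w + d₀)/P)` and the assembly of the rows into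
`E₁,χ(z, s)` are the next files.

## References

* E. Hecke, *Theorie der Eisensteinschen Reihen höherer Stufe…*, Abh. Math. Sem. Hamburg 5 (1927),
  §2.
* B. Schoeneberg, *Elliptic Modular Functions*, Springer (1974), Ch. VII §2.
-/

noncomputable section

open Complex Real Set MeasureTheory intervalIntegral Filter Finset
open scoped ComplexConjugate Topology
open Literature.NumberTheory.LFunctions

namespace Literature.NumberTheory.EllipticCurves.ModularForms

/-! ### The objects -/

/-- The second difference `∇²k(w, s; d) = k(d-2) - 2k(d-1) + k(d)` of the row kernel over the
integers. [folklore] -/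
def secondDiffRowKernel (w s : ℂ) (d : ℤ) : ℂ :=
  rowKernel w s ((d : ℝ) - 2) - 2 * rowKernel w s ((d : ℝ) - 1) + rowKernel w s d

/-- **The row** `R(χ, w, s) = ∑_{d ∈ ℤ} χ(d) (d+w)^{-1-s} (d+w̄)^{-s}` of the weight-one Eisenstein
series (absolutely convergent for `Re s > 0`; a `tsum`, hence junk, elsewhere). [folklore] -/
def rowSum (χ : ℤ → ℂ) (w s : ℂ) : ℂ := ∑' d : ℤ, χ d * rowKernel w s d

/-- **The continued row** `R̃(χ, w, s) = ∑_{d ∈ ℤ} W₀₀(d) ∇²k(w, s; d)`, `W₀₀` the mean-zero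
periodic second primitive of the `P`-periodic weight `χ` (`PeriodicAbel.primitive₀` twice);
absolutely convergent for `Re s > -1`. [folklore] -/
def rowCont (P : ℕ) (χ : ℤ → ℂ) (w s : ℂ) : ℂ :=
  ∑' d : ℤ, PeriodicAbel.primitive₀ P (PeriodicAbel.primitive₀ P χ) d * secondDiffRowKernel w s d

/-! ### Lattice sums `∑_{d ∈ ℤ} |d + w|^{-a}` -/

section Lattice

variable {w : ℂ} (hw : 0 < w.im)
include hw

/-- `|d + w| ≥ (min(Im w, 1)/2) (1 + |d + Re w|)`. [folklore] -/
theorem norm_int_add_ge (d : ℤ) :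
    min w.im 1 / 2 * (1 + |(d : ℝ) + w.re|) ≤ ‖(d : ℂ) + w‖ := by
  have hη : 0 < w.im := hw
  have h1 : |(d : ℝ) + w.re| ≤ ‖(d : ℂ) + w‖ := by
    have := abs_re_le_norm ((d : ℂ) + w)
    simpa using this
  have h2 : w.im ≤ ‖(d : ℂ) + w‖ := by
    have := abs_im_le_norm ((d : ℂ) + w)
    simpa [abs_of_pos hη] using this
  have hm1 : min w.im 1 ≤ 1 := min_le_right _ _
  have hm2 : min w.im 1 ≤ w.im := min_le_left _ _
  have hm0 : 0 < min w.im 1 := lt_min hη one_pos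
  nlinarith [abs_nonneg ((d : ℝ) + w.re)]

/-- **`∑_{d ∈ ℤ} |d + w|^{-a} < ∞` for `a > 1`** (comparison with Mathlib's
`Real.summable_one_div_int_add_rpow`). [folklore] -/
theorem summable_norm_int_add_rpow_neg {a : ℝ} (ha : 1 < a) :
    Summable fun d : ℤ ↦ ‖(d : ℂ) + w‖ ^ (-a) := by
  have hη : 0 < w.im := hw
  set m : ℝ := min w.im 1 / 2 with hm
  have hm0 : 0 < m := by rw [hm]; exact div_pos (lt_min hη one_pos) two_pos
  -- the comparison series `m^{-a} (1 + |d + x|)^{-a} ≤ m^{-a} |d + x|^{-a}` off the zero of `d + x`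
  have hg : Summable fun d : ℤ ↦ m ^ (-a) * (1 / |(d : ℝ) + w.re| ^ a) :=
    ((Real.summable_one_div_int_add_rpow w.re a).mpr ha).mul_left _
  refine Summable.of_norm_bounded_eventually hg ?_
  have hfin : {d : ℤ | (d : ℝ) + w.re = 0}.Finite := by
    refine Set.Subsingleton.finite fun d hd e he ↦ ?_
    simp only [Set.mem_setOf_eq] at hd he
    exact_mod_cast (show (d : ℝ) = e by linarith)
  have hpt : ∀ d : ℤ, (d : ℝ) + w.re ≠ 0 →
      ‖‖(d : ℂ) + w‖ ^ (-a)‖ ≤ m ^ (-a) * (1 / |(d : ℝ) + w.re| ^ a) := by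
    intro d hd
    have hpos : 0 < |(d : ℝ) + w.re| := abs_pos.mpr hd
    have hL : 0 < ‖(d : ℂ) + w‖ := lt_of_lt_of_le (by positivity) (norm_int_add_ge hw d)
    rw [Real.norm_of_nonneg (Real.rpow_nonneg hL.le _)]
    calc ‖(d : ℂ) + w‖ ^ (-a) ≤ (m * (1 + |(d : ℝ) + w.re|)) ^ (-a) :=
          Real.rpow_le_rpow_of_nonpos (by positivity) (norm_int_add_ge hw d) (by linarith)
      _ = m ^ (-a) * (1 + |(d : ℝ) + w.re|) ^ (-a) := Real.mul_rpow hm0.le (by positivity)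
      _ ≤ m ^ (-a) * (1 / |(d : ℝ) + w.re| ^ a) := by
          refine mul_le_mul_of_nonneg_left ?_ (Real.rpow_nonneg hm0.le _)
          rw [Real.rpow_neg (by positivity), one_div]
          exact inv_anti₀ (Real.rpow_pos_of_pos hpos _)
            (Real.rpow_le_rpow (abs_nonneg _) (by linarith) (by linarith))
  exact Filter.eventually_cofinite.2 (hfin.subset fun d hd ↦ by
    by_contra hne
    exact hd (hpt d hne))

/-- **`∑_{d ∈ ℤ} ‖k(w, s; d)‖ < ∞` for `Re s > 0`.** [folklore] -/
theorem summable_norm_rowKernel_int {s : ℂ} (hs : 0 < s.re) :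
    Summable fun d : ℤ ↦ ‖rowKernel w s d‖ := by
  have h := (summable_norm_int_add_rpow_neg hw (a := 1 + 2 * s.re) (by linarith)).mul_left
    (Real.exp (2 * π * |s.im|))
  refine Summable.of_nonneg_of_le (fun _ ↦ norm_nonneg _) (fun d ↦ ?_) h
  have := norm_rowKernel_le hw s d
  rw [show -1 - 2 * s.re = -(1 + 2 * s.re) by ring] at this
  exact_mod_cast this

/-- Hence `∑_d ‖χ(d) k(w, s; d)‖ < ∞` for a bounded weight and `Re s > 0`. [folklore] -/
theorem summable_norm_mul_rowKernel_int {χ : ℤ → ℂ} {B : ℝ} (hB : ∀ d, ‖χ d‖ ≤ B) {s : ℂ}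
    (hs : 0 < s.re) : Summable fun d : ℤ ↦ ‖χ d * rowKernel w s d‖ := by
  have hB0 : 0 ≤ B := (norm_nonneg _).trans (hB 0)
  refine Summable.of_nonneg_of_le (fun _ ↦ norm_nonneg _) (fun d ↦ ?_)
    ((summable_norm_rowKernel_int hw hs).mul_left B)
  rw [norm_mul]
  exact mul_le_mul_of_nonneg_right (hB d) (norm_nonneg _)

end Lattice

/-! ### The row is its continuation for `Re s > 0` -/

section AbelTwice

variable {P : ℕ} (hP : 0 < P) {χ : ℤ → ℂ} (hχ : Function.Periodic χ (P : ℤ))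
  (hmean : ∑ i ∈ Finset.range P, χ i = 0) {w : ℂ} (hw : 0 < w.im)
include hP hχ hmean hw

/-- **`R(χ, w, s) = R̃(χ, w, s)` for `Re s > 0`** (Abel summation twice against the periodic
mean-zero weight; both sides converge absolutely). [folklore] -/
theorem rowSum_eq_rowCont {s : ℂ} (hs : 0 < s.re) : rowSum χ w s = rowCont P χ w s := by
  unfold rowSum rowCont
  rw [PeriodicAbel.tsum_mul_eq_tsum_mul_secondDiff hP hχ hmean
    (f := fun d : ℤ ↦ rowKernel w s d) (summable_norm_rowKernel_int hw hs)]
  refine tsum_congr fun d ↦ ?_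
  simp only [secondDiffRowKernel]
  push_cast
  ring_nf

end AbelTwice

/-! ### The norm bound and the holomorphy of the continued row -/

section Continuation

variable {P : ℕ} (hP : 0 < P) (χ : ℤ → ℂ) {w : ℂ} (hw : 0 < w.im)
include hP hw

/-- **`‖R̃(χ, w, s)‖ ≤ 40 P (∑_{i mod P}‖χ i‖) (1+‖s‖)² e^{2π|Im s|} I(3+2σ) (Im w)^{-2-2σ}`** for
`σ = Re s > -1`, `I(a) = ∫_ℝ (1+v²)^{-a/2} dv` (the bounded second primitive against the row bound
of `EisensteinWeightOneRowKernel`). [folklore] -/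
theorem norm_rowCont_le {s : ℂ} (hs : -1 < s.re) :
    ‖rowCont P χ w s‖ ≤ (4 * P * ∑ i ∈ Finset.range P, ‖χ i‖) *
      (10 * (1 + ‖s‖) ^ 2 * Real.exp (2 * π * |s.im|) *
        (∫ v : ℝ, (1 + v ^ 2) ^ (-(3 + 2 * s.re) / 2)) * w.im ^ (-2 - 2 * s.re)) := by
  obtain ⟨hsum, hle⟩ := tsum_norm_secondDiff_rowKernel_le hw hs
  unfold rowCont
  refine (PeriodicAbel.norm_tsum_mul_le (PeriodicAbel.norm_primitive₀_primitive₀_le hP)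
    (h := secondDiffRowKernel w s) hsum).trans ?_
  exact mul_le_mul_of_nonneg_left hle (by positivity)

omit hP in
/-- Each term of the continued row is an entire function of `s`. [folklore] -/
theorem differentiable_rowKernel_s (t : ℝ) : Differentiable ℂ fun s : ℂ ↦ rowKernel w s t := by
  intro s
  unfold rowKernel
  refine DifferentiableAt.mul ?_ ?_
  · exact ((differentiableAt_const _).sub differentiableAt_id).const_cpow
      (Or.inl (ofReal_add_ne_zero hw t))
  · exact differentiableAt_id.neg.const_cpow (Or.inl (ofReal_add_conj_ne_zero hw t))

omit hP in
/-- `∇²k(w, s; d)` is entire in `s`. [folklore] -/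
theorem differentiable_secondDiffRowKernel_s (d : ℤ) :
    Differentiable ℂ fun s : ℂ ↦ secondDiffRowKernel w s d := by
  unfold secondDiffRowKernel
  exact ((differentiable_rowKernel_s hw _).sub
    ((differentiable_const _).mul (differentiable_rowKernel_s hw _))).add
    (differentiable_rowKernel_s hw _)

omit hP in
/-- On `a < Re s < b`: `|u+w|^{-3-2 Re s} ≤ |u+w|^{-3-2a} + |u+w|^{-3-2b}`. [folklore] -/
theorem rpow_exponent_between_le {a b : ℝ} {s : ℂ} (ha : a < s.re) (hb : s.re < b) (u : ℝ) :
    ‖(u : ℂ) + w‖ ^ (-3 - 2 * s.re) ≤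
      ‖(u : ℂ) + w‖ ^ (-3 - 2 * a) + ‖(u : ℂ) + w‖ ^ (-3 - 2 * b) := by
  have hL : 0 < ‖(u : ℂ) + w‖ := norm_pos_iff.mpr (ofReal_add_ne_zero hw u)
  rcases le_or_gt ‖(u : ℂ) + w‖ 1 with h1 | h1
  · have : ‖(u : ℂ) + w‖ ^ (-3 - 2 * s.re) ≤ ‖(u : ℂ) + w‖ ^ (-3 - 2 * b) :=
      Real.rpow_le_rpow_of_exponent_ge hL h1 (by linarith)
    linarith [Real.rpow_nonneg hL.le (-3 - 2 * a)]
  · have : ‖(u : ℂ) + w‖ ^ (-3 - 2 * s.re) ≤ ‖(u : ℂ) + w‖ ^ (-3 - 2 * a) :=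
      Real.rpow_le_rpow_of_exponent_le h1.le (by linarith)
    linarith [Real.rpow_nonneg hL.le (-3 - 2 * b)]

/-- **Holomorphy on a box**: `s ↦ R̃(χ, w, s)` is complex differentiable on
`{a < Re s < b, |Im s| < T}` whenever `-1 < a` (dominated termwise by
`C ∫_{d-2}^{d} (|u+w|^{-3-2a} + |u+w|^{-3-2b}) du`). [folklore] -/
theorem differentiableOn_rowCont_box {a b T : ℝ} (ha : -1 < a) (hab : a < b) (hT : 0 < T) :
    DifferentiableOn ℂ (rowCont P χ w) {s : ℂ | a < s.re ∧ s.re < b ∧ |s.im| < T} := by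
  set U : Set ℂ := {s : ℂ | a < s.re ∧ s.re < b ∧ |s.im| < T} with hU
  have hUo : IsOpen U :=
    (isOpen_lt continuous_const Complex.continuous_re).inter
      ((isOpen_lt Complex.continuous_re continuous_const).inter
        (isOpen_lt (continuous_abs.comp Complex.continuous_im) continuous_const))
  -- constants
  set B : ℝ := 4 * P * ∑ i ∈ Finset.range P, ‖χ i‖ with hB
  have hB0 : 0 ≤ B := by positivity
  set S : ℝ := |a| + |b| + T with hS
  have hS0 : 0 ≤ S := by positivity
  set K : ℝ := 5 * (1 + S) ^ 2 * Real.exp (2 * π * T) with hK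
  have hK0 : 0 ≤ K := by positivity
  -- the majorant
  set g : ℝ → ℝ := fun u ↦ ‖(u : ℂ) + w‖ ^ (-3 - 2 * a) + ‖(u : ℂ) + w‖ ^ (-3 - 2 * b) with hg
  have hga : Integrable fun u : ℝ ↦ ‖(u : ℂ) + w‖ ^ (-3 - 2 * a) := by
    simpa [show -(3 + 2 * a) = -3 - 2 * a by ring] using
      integrable_norm_ofReal_add_rpow_neg hw (a := 3 + 2 * a) (by linarith)
  have hgb : Integrable fun u : ℝ ↦ ‖(u : ℂ) + w‖ ^ (-3 - 2 * b) := by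
    simpa [show -(3 + 2 * b) = -3 - 2 * b by ring] using
      integrable_norm_ofReal_add_rpow_neg hw (a := 3 + 2 * b) (by linarith)
  have hgi : Integrable g := hga.add hgb
  have hgsum : Summable fun d : ℤ ↦ B * K * ∫ u in ((d : ℝ) - 2)..d, g u :=
    ((hasSum_intervalIntegral_two_int hgi).mul_left (B * K)).summable
  unfold rowCont
  refine differentiableOn_tsum_of_summable_norm hgsum
    (fun d ↦ ((differentiable_const _).mul
      (differentiable_secondDiffRowKernel_s hw d)).differentiableOn) hUo ?_
  intro d s hs
  obtain ⟨hsa, hsb, hsT⟩ := hs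
  -- ‖s‖ ≤ S, e^{2π|Im s|} ≤ e^{2πT}
  have hsn : ‖s‖ ≤ S := by
    calc ‖s‖ ≤ |s.re| + |s.im| := Complex.norm_le_abs_re_add_abs_im s
      _ ≤ (|a| + |b|) + T := by
          refine add_le_add ?_ hsT.le
          rcases le_or_gt 0 s.re with h | h
          · rw [abs_of_nonneg h]; linarith [le_abs_self b, abs_nonneg a]
          · rw [abs_of_neg h]; linarith [neg_le_abs a, abs_nonneg b]
      _ = S := by rw [hS]
  have hexp : Real.exp (2 * π * |s.im|) ≤ Real.exp (2 * π * T) :=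
    Real.exp_le_exp.mpr (by nlinarith [Real.pi_pos, hsT.le])
  -- the termwise bound
  rw [norm_mul, mul_assoc]
  refine mul_le_mul (PeriodicAbel.norm_primitive₀_primitive₀_le hP d) ?_ (norm_nonneg _) hB0
  have hcont1 : Continuous fun u : ℝ ↦ ‖rowKernel₂ w s u‖ := (continuous_rowKernel₂ hw s).norm
  have hcL : Continuous fun u : ℝ ↦ ‖(u : ℂ) + w‖ := (continuous_ofReal.add continuous_const).norm
  have hne : ∀ u : ℝ, ‖(u : ℂ) + w‖ ≠ 0 := fun u ↦ (norm_pos_iff.mpr (ofReal_add_ne_zero hw u)).ne'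
  have hcont2 : Continuous fun u : ℝ ↦ ‖(u : ℂ) + w‖ ^ (-3 - 2 * s.re) :=
    hcL.rpow_const fun u ↦ Or.inl (hne u)
  have hcontg : Continuous g :=
    (hcL.rpow_const fun u ↦ Or.inl (hne u)).add (hcL.rpow_const fun u ↦ Or.inl (hne u))
  calc ‖secondDiffRowKernel w s d‖ ≤ ∫ u in ((d : ℝ) - 2)..d, ‖rowKernel₂ w s u‖ :=
        norm_secondDiff_rowKernel_le_integral hw s d
    _ ≤ 5 * (1 + ‖s‖) ^ 2 * Real.exp (2 * π * |s.im|) *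
          ∫ u in ((d : ℝ) - 2)..d, ‖(u : ℂ) + w‖ ^ (-3 - 2 * s.re) :=
        integral_norm_rowKernel₂_le hw s d
    _ ≤ K * ∫ u in ((d : ℝ) - 2)..d, g u := by
        have hI0 : 0 ≤ ∫ u in ((d : ℝ) - 2)..d, ‖(u : ℂ) + w‖ ^ (-3 - 2 * s.re) :=
          intervalIntegral.integral_nonneg (by linarith) fun u _ ↦
            Real.rpow_nonneg (norm_nonneg _) _
        have hI : ∫ u in ((d : ℝ) - 2)..d, ‖(u : ℂ) + w‖ ^ (-3 - 2 * s.re) ≤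
            ∫ u in ((d : ℝ) - 2)..d, g u :=
          intervalIntegral.integral_mono_on (by linarith) (hcont2.intervalIntegrable _ _)
            (hcontg.intervalIntegrable _ _) fun u _ ↦ rpow_exponent_between_le hw hsa hsb u
        have hcoef : 5 * (1 + ‖s‖) ^ 2 * Real.exp (2 * π * |s.im|) ≤ K := by
          rw [hK]
          refine mul_le_mul ?_ hexp (by positivity) (by positivity)
          nlinarith [norm_nonneg s, hsn]
        exact mul_le_mul hcoef hI hI0 hK0

/-- **`s ↦ R̃(χ, w, s)` is holomorphic on `Re s > -1`.** [folklore] -/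
theorem differentiableOn_rowCont :
    DifferentiableOn ℂ (rowCont P χ w) {s : ℂ | -1 < s.re} := by
  intro s₀ hs₀
  simp only [Set.mem_setOf_eq] at hs₀
  set a : ℝ := (-1 + s₀.re) / 2 with ha
  set b : ℝ := s₀.re + 1 with hb
  set T : ℝ := |s₀.im| + 1 with hT
  have ha' : -1 < a := by rw [ha]; linarith
  have hab : a < b := by rw [ha, hb]; linarith
  have hT' : 0 < T := by rw [hT]; positivity
  have hmem : s₀ ∈ {s : ℂ | a < s.re ∧ s.re < b ∧ |s.im| < T} :=
    ⟨by rw [ha]; linarith, by rw [hb]; linarith, by rw [hT]; linarith⟩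
  have hUo : IsOpen {s : ℂ | a < s.re ∧ s.re < b ∧ |s.im| < T} :=
    (isOpen_lt continuous_const Complex.continuous_re).inter
      ((isOpen_lt Complex.continuous_re continuous_const).inter
        (isOpen_lt (continuous_abs.comp Complex.continuous_im) continuous_const))
  exact ((differentiableOn_rowCont_box hP χ hw ha' hab hT').differentiableAt
    (hUo.mem_nhds hmem)).differentiableWithinAt

/-- `s ↦ R̃(χ, w, s)` is complex differentiable at every `s` with `Re s > -1`. [folklore] -/
theorem differentiableAt_rowCont {s : ℂ} (hs : -1 < s.re) :
    DifferentiableAt ℂ (rowCont P χ w) s :=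
  (differentiableOn_rowCont hP χ hw).differentiableAt
    ((isOpen_lt continuous_const Complex.continuous_re).mem_nhds hs)

/-- `s ↦ R̃(χ, w, s)` is continuous at every `s` with `Re s > -1`. [folklore] -/
theorem continuousAt_rowCont {s : ℂ} (hs : -1 < s.re) : ContinuousAt (rowCont P χ w) s :=
  (differentiableAt_rowCont hP χ hw hs).continuousAt

end Continuation

end Literature.NumberTheory.EllipticCurves.ModularForms
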